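/-
Copyright (c) 2026 the pub-hodgecm-mathlib formalisation cell (harness21).  Prover seat hodgecm-mathlib-F0P2-p01 (g14), 2026-09-01.  Road «S3-tree», organ (I) piece N2′
(architect A-p16 (g30) A-139): the TYPE-FREE twin of ★ N2 `shifted_order_memberships` — the shifted order memberships of the Cayley∕Möbius shift of a match of a 2-DEEP `γ_H`.
-/
import Literature.NumberTheory.Rogawski1990.TypeTwoCayleyShiftOrderCM     -- ★ N2 (F0P2-p06 (g10)): `smul_units_conj_add_smul_one`, `units_conj_nonsing_inv`; brings ★ γ₃∕γ₂∕γ₁∕α∕β, `TypeTwoCayleyShiftCM`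
import Literature.NumberTheory.Automorphic.UnitaryLatticeTreeLevelShift     -- ★ p845386 (this lineage): `v_det_eq_one_of_forall_v_sub_one_lt_one` (`M ≡ 1 (𝔪)` ⇒ `|det M| = 1`)
import HarnessLib

/-!
# The shifted order at a CM place for a 2-deep `γ_H`, TYPE-FREE: `φ(δ)_w, φ(δ)_w⁻¹ ∈ 𝒪_w[1 + c_w⁻¹(δ_w − 1)]` and `1 + c_w⁻¹(δ_w − 1) ∈ 𝒪_w[φ(δ)_w]`
# (road «S3-tree», organ (I) N2′; Kottwitz 1986 §3, Rogawski 1990 §4.9 Prop. 4.9.1 (b))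

Topic `NumberTheory/Rogawski1990`; namespace `Literature.NumberTheory.Rogawski1990`.  THEOREMS ONLY (no definition, no instance, no notation, no named fact, no `sorry`); kernel lane
`--supports stmt-HodgeConjecture-24833`.  Cell `pub/hodgecm-mathlib`, crux H413; road «S3-tree» (architect A-p16 (g30) A-139: organ (I) `stub_liftInterior` split N1…N6; N2′ + N3 → this
seat; consumer of N2′ = N3 `LevelTwoInteriorOrbitalTransport` through ★ p846407 `sum_fixedBy_interior_eq_sum_fixedBy_cayley_relabel`, whose `hu hu′ hX` are EXACTLY the three
memberships below, over the `Valued` integers).  Seat F0P2-p01 (g14).  HONEST LABEL: HC_CM is proved only modulo the 2 remaining named inputs (hLiu418 24832, h413 24833) until rung 0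
closes; this file is an assembly over ★ material and asserts nothing printed.

THE MATHEMATICS (the proof of ★ N2 with the type-(2) block computation replaced by ONE type-free deepness hypothesis).  `ι(γ_H)_w = 1 + c_w·W`, `W = c_w⁻¹(ι(γ_H)_w − 1)`; if `γ_H` is
2-DEEP (`ι(γ_H)_w ≡ 1 (mod c_w²)` entrywise) then `W ≡ 0 (mod c_w)` entrywise, so `N± = 2·1 + (c_w ± 1)W = 2·(1 + ((c_w ± 1)∕2)W)` with `((c_w ± 1)∕2)W ≡ 0 (𝔪)` have
UNIT determinants (★ `v_det_eq_one_of_forall_v_sub_one_lt_one`, `|2|_w = 1`).  ★ FILE α §4 then gives `Y₀ := N₊N₋⁻¹ = φ(ι(γ_H)_w) ∈ 𝒪_w[W]`, `Y₀⁻¹ ∈ 𝒪_w[W]`, `W ∈ 𝒪_w[Y₀]`; a match `δ` is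
`x·ι(γ_H)·x⁻¹` in `GL₃(E_v)`, so `δ_w = x_w ι_w x_w⁻¹`, `φ(δ_w) = x_w Y₀ x_w⁻¹` (★ α `moebius_conj`), `1 + c_w⁻¹(δ_w − 1) = x_w(1 + W)x_w⁻¹`, and conjugation transports the
memberships (★ γ₂ `conj_mem_adjoin_of_mem_adjoin`).  No `σ`, no discriminant, no torus type.

## References
* [Kottwitz1986] R. E. Kottwitz, *Base change for unit elements of Hecke algebras*, Compositio Math. 60 (1986), §3.
* [Rogawski1990] J. D. Rogawski, *Automorphic Representations of Unitary Groups in Three Variables* (1990), §4.9 Prop. 4.9.1 (b) p. 55.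
* [Serre1980Trees] J.-P. Serre, *Trees* (1980), Ch. II §1.1–1.2.
-/

set_option autoImplicit false

noncomputable section

open NumberField IsDedekindDomain Matrix Polynomial
open scoped MatrixGroups WithZero Valued

namespace Literature.NumberTheory.Rogawski1990

open Literature.NumberTheory.Automorphic Literature.NumberTheory.Automorphic.UnitaryGroup Literature.NumberTheory.Automorphic.MoebiusShift
  Literature.NumberTheory.Automorphic.UnitaryLatticeTree Literature.NumberTheory.GaloisRepresentations Literature.NumberTheory.NumberFields

set_option maxHeartbeats 1600000 in
-- the carriers' types are large (same budget as ★ N2)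
/-- **N2′ «THE SHIFTED ORDER MEMBERSHIPS, TYPE-FREE»** (twin of ★ N2 `shifted_order_memberships`): at a non-split place (`σ • w = w`), for a 2-DEEP `γ_H`
(`ι_v(γ_H)_w ≡ 1 (mod c_w²)` entrywise, `|c_w| = exp(−1)`, `|2|_w = 1`), a match `δ` of `γ_H` and `δ′` with matrix `φ_c(δ)`: with `Y := (δ′)_w`, `X_δ := 1 + c_w⁻¹((δ)_w − 1)`,
`Y ∈ 𝒪_w[X_δ]`, `Y⁻¹ ∈ 𝒪_w[X_δ]`, `X_δ ∈ 𝒪_w[Y]` (`𝒪_w` the `Valued` integers — the currency of ★ p846407's `hu hu′ hX`). [cite: Kottwitz1986, §3]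
[cite: Rogawski1990, §4.9 Prop. 4.9.1 (b) p. 55] [cite: Serre1980Trees, Ch. II §1.1–1.2] -/
theorem shifted_order_memberships_of_deep (L : Type) [Field L] [NumberField L] [IsCMField L] (H' : Matrix (Fin 3) (Fin 3) L)
    {v : HeightOneSpectrum (𝓞 ↥(maximalRealSubfield L))} (w : PlacesOver L v) (hw : IsCMField.complexConj L • w.1 = w.1)
    (γH : (cmDatum L 2 (Matrix.of fun i j : Fin 2 => if i.val + j.val + 1 = 2 then (1 : L) else 0)).Local v ×
      (cmDatum L 1 (Matrix.of fun i j : Fin 1 => if i.val + j.val + 1 = 1 then (1 : L) else 0)).Local v)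
    (δ δ' : (cmDatum L 3 H').Local v)
    {c : LocalRing L v} (hc : Valued.v (c w) = WithZero.exp (-1 : ℤ)) (h2 : Valued.v (2 : w.1.adicCompletion L) = 1)
    (hdeep : ∀ i j, Valued.v (((((endoEmbLocal L v γH).val : GL (Fin 3) (LocalRing L v)).val.map
        (Pi.evalRingHom (fun w' : PlacesOver L v => w'.1.adicCompletion L) w)) - 1) i j) ≤ Valued.v (c w) ^ 2)
    (h : IsLocalNormPair L H' v γH δ)
    (hδ : ((δ'.val : GL (Fin 3) (LocalRing L v)).val : Matrix (Fin 3) (Fin 3) (LocalRing L v)) =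
      ((c + 1) • ((δ.val : GL (Fin 3) (LocalRing L v)).val : Matrix (Fin 3) (Fin 3) (LocalRing L v)) + (c - 1) • 1) *
        ((c - 1) • ((δ.val : GL (Fin 3) (LocalRing L v)).val : Matrix (Fin 3) (Fin 3) (LocalRing L v)) + (c + 1) • 1)⁻¹) :
    ((δ'.val : GL (Fin 3) (LocalRing L v)).val.map (Pi.evalRingHom (fun w' : PlacesOver L v => w'.1.adicCompletion L) w)) ∈
        Algebra.adjoin 𝒪[w.1.adicCompletion L] ({1 + (c w)⁻¹ • (((δ.val : GL (Fin 3) (LocalRing L v)).val.map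
          (Pi.evalRingHom (fun w' : PlacesOver L v => w'.1.adicCompletion L) w)) - 1)} : Set (Matrix (Fin 3) (Fin 3) (w.1.adicCompletion L))) ∧
      ((δ'.val : GL (Fin 3) (LocalRing L v)).val.map (Pi.evalRingHom (fun w' : PlacesOver L v => w'.1.adicCompletion L) w))⁻¹ ∈
        Algebra.adjoin 𝒪[w.1.adicCompletion L] ({1 + (c w)⁻¹ • (((δ.val : GL (Fin 3) (LocalRing L v)).val.map
          (Pi.evalRingHom (fun w' : PlacesOver L v => w'.1.adicCompletion L) w)) - 1)} : Set (Matrix (Fin 3) (Fin 3) (w.1.adicCompletion L))) ∧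
      (1 + (c w)⁻¹ • (((δ.val : GL (Fin 3) (LocalRing L v)).val.map (Pi.evalRingHom (fun w' : PlacesOver L v => w'.1.adicCompletion L) w)) - 1)) ∈
        Algebra.adjoin 𝒪[w.1.adicCompletion L] ({((δ'.val : GL (Fin 3) (LocalRing L v)).val.map
          (Pi.evalRingHom (fun w' : PlacesOver L v => w'.1.adicCompletion L) w))} : Set (Matrix (Fin 3) (Fin 3) (w.1.adicCompletion L))) := by
  have hv : Subsingleton (PlacesOver L v) := PlacesOver.subsingleton_of_smul_eq (IsCMField.complexConj L) (IsCMField.complexConj_ne_one L) w hw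
  set evw : LocalRing L v →+* w.1.adicCompletion L := Pi.evalRingHom (fun w' : PlacesOver L v => w'.1.adicCompletion L) w with hevw
  set O : Subring (w.1.adicCompletion L) := 𝒪[w.1.adicCompletion L] with hOdef
  have hO : ∀ {z : w.1.adicCompletion L}, z ∈ O ↔ Valued.v z ≤ 1 := fun {z} => Valuation.mem_integer_iff _ _
  set cw : w.1.adicCompletion L := c w with hcw
  set ιw : Matrix (Fin 3) (Fin 3) (w.1.adicCompletion L) := (((endoEmbLocal L v γH).val : GL (Fin 3) (LocalRing L v)).val.map evw) with hιw
  set δw : Matrix (Fin 3) (Fin 3) (w.1.adicCompletion L) := ((δ.val : GL (Fin 3) (LocalRing L v)).val.map evw) with hδw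
  obtain ⟨hc0, hc1, hcm, hcp, -, -⟩ := shift_parameter_facts hc
  -- `W = c_w⁻¹(ι_w − 1)`, `ι_w = 1 + c_w W`, and 2-deepness: `|W_{ij}| ≤ |c_w| < 1`
  set W : Matrix (Fin 3) (Fin 3) (w.1.adicCompletion L) := cw⁻¹ • (ιw - 1) with hW
  have hιW : ιw = 1 + cw • W := eq_one_add_smul_inv_smul_sub_one hc0 ιw
  clear_value W
  have hWc : ∀ i j, Valued.v (W i j) ≤ Valued.v cw := by
    intro i j
    rw [hW, Matrix.smul_apply, smul_eq_mul, map_mul, map_inv₀]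
    have hdij := hdeep i j
    have hvc0 : Valued.v cw ≠ 0 := (Valuation.ne_zero_iff _).2 hc0
    calc (Valued.v cw)⁻¹ * Valued.v ((ιw - 1) i j) ≤ (Valued.v cw)⁻¹ * Valued.v cw ^ 2 := mul_le_mul_right hdij _
      _ = Valued.v cw := by rw [sq, ← mul_assoc, inv_mul_cancel₀ hvc0, one_mul]
  have hWi : ∀ i j, Valued.v (W i j) ≤ 1 := fun i j => (hWc i j).trans hc1.le
  have hWO : ∀ i j, W i j ∈ O := fun i j => hO.2 (hWi i j)
  have hcO : cw ∈ O := hO.2 hc1.le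
  -- the determinants of `N± = 2·1 + (c_w ± 1)W = 2·(1 + (t∕2)W)` are units: `(t∕2)W ≡ 0 (mod 𝔪)` (★ `v_det_eq_one_of_forall_v_sub_one_lt_one`)
  have h20 : (2 : w.1.adicCompletion L) ≠ 0 := fun h0 => by rw [h0, map_zero] at h2; exact zero_ne_one h2
  have hdet : ∀ {t : w.1.adicCompletion L}, Valued.v t = 1 →
      Valued.v ((2 : w.1.adicCompletion L) • (1 : Matrix (Fin 3) (Fin 3) (w.1.adicCompletion L)) + t • W).det = 1 := by
    intro t ht
    have e : (2 : w.1.adicCompletion L) • (1 : Matrix (Fin 3) (Fin 3) (w.1.adicCompletion L)) + t • W =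
        (2 : w.1.adicCompletion L) • (1 + ((2 : w.1.adicCompletion L)⁻¹ * t) • W) := by
      rw [smul_add, smul_smul, ← mul_assoc, mul_inv_cancel₀ h20, one_mul]
    have hM : ∀ i k, Valued.v (((1 + ((2 : w.1.adicCompletion L)⁻¹ * t) • W) - 1) i k) < 1 := fun i k => by
      rw [add_sub_cancel_left, Matrix.smul_apply, smul_eq_mul, map_mul, map_mul, map_inv₀, h2, ht, inv_one, one_mul, one_mul]
      exact (hWc i k).trans_lt hc1
    rw [e, Matrix.det_smul, Fintype.card_fin, map_mul, map_pow, h2, one_pow, one_mul]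
    exact v_det_eq_one_of_forall_v_sub_one_lt_one _ hM
  have hunit : ∀ {z : w.1.adicCompletion L}, Valued.v z = 1 → ∃ d ∈ O, d * z = 1 := fun {z} hz => by
    have hz0 : z ≠ 0 := fun h0 => by rw [h0, map_zero] at hz; exact zero_ne_one hz
    exact ⟨z⁻¹, hO.2 (by rw [map_inv₀, hz, inv_one]), inv_mul_cancel₀ hz0⟩
  have hm : ∃ d ∈ O, d * ((2 : w.1.adicCompletion L) • (1 : Matrix (Fin 3) (Fin 3) (w.1.adicCompletion L)) + (cw - 1) • W).det = 1 := hunit (hdet hcm)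
  have hp : ∃ d ∈ O, d * ((2 : w.1.adicCompletion L) • (1 : Matrix (Fin 3) (Fin 3) (w.1.adicCompletion L)) + (cw + 1) • W).det = 1 := hunit (hdet hcp)
  have h2O : ∃ e ∈ O, e * 2 = 1 := hunit h2
  have hc1O : ∃ e ∈ O, e * (cw - 1) = 1 := hunit hcm
  -- ★ FILE α §4: the order identity for `W`
  set Y₀ : Matrix (Fin 3) (Fin 3) (w.1.adicCompletion L) := ((2 : w.1.adicCompletion L) • (1 : Matrix (Fin 3) (Fin 3) (w.1.adicCompletion L)) + (cw + 1) • W) *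
    ((2 : w.1.adicCompletion L) • (1 : Matrix (Fin 3) (Fin 3) (w.1.adicCompletion L)) + (cw - 1) • W)⁻¹ with hY₀
  have hY₀mem : Y₀ ∈ Algebra.adjoin O ({W} : Set (Matrix (Fin 3) (Fin 3) (w.1.adicCompletion L))) := moebius_mem_adjoin O hWO hcO hm
  have hY₀inv : Y₀⁻¹ ∈ Algebra.adjoin O ({W} : Set (Matrix (Fin 3) (Fin 3) (w.1.adicCompletion L))) := moebius_inv_mem_adjoin O hWO hcO hm hp
  have hWmem : W ∈ Algebra.adjoin O ({Y₀} : Set (Matrix (Fin 3) (Fin 3) (w.1.adicCompletion L))) := mem_adjoin_moebius O hWO hcO h2O hc1O hm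
  -- the match: `δ_w = x_w ι_w x_w⁻¹`
  obtain ⟨x, hx⟩ := isConj_iff.1 h
  have hxdet : IsUnit (((x : GL (Fin 3) (LocalRing L v)) : Matrix (Fin 3) (Fin 3) (LocalRing L v)).map evw).det := by
    rw [← RingHom.mapMatrix_apply, ← RingHom.map_det]; exact (Matrix.isUnits_det_units x).map _
  set P : GL (Fin 3) (w.1.adicCompletion L) := Matrix.nonsingInvUnit _ hxdet with hP
  have hPv : (P : Matrix (Fin 3) (Fin 3) (w.1.adicCompletion L)) = ((x : GL (Fin 3) (LocalRing L v)) : Matrix (Fin 3) (Fin 3) (LocalRing L v)).map evw := rfl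
  have hPi : ((P⁻¹ : GL (Fin 3) (w.1.adicCompletion L)) : Matrix (Fin 3) (Fin 3) (w.1.adicCompletion L)) = (((x : GL (Fin 3) (LocalRing L v)) : Matrix (Fin 3) (Fin 3) (LocalRing L v)).map evw)⁻¹ := by
    rw [Matrix.coe_units_inv, hPv]
  have hmx : ((δ.val : GL (Fin 3) (LocalRing L v)).val : Matrix (Fin 3) (Fin 3) (LocalRing L v)) =
      (x : GL (Fin 3) (LocalRing L v)).val * (((endoEmbLocal L v γH).val : GL (Fin 3) (LocalRing L v)).val) * (x⁻¹ : GL (Fin 3) (LocalRing L v)).val := by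
    rw [← hx, Units.val_mul, Units.val_mul]; rfl
  have hδconj : δw = (P : Matrix (Fin 3) (Fin 3) (w.1.adicCompletion L)) * ιw * ((P⁻¹ : GL (Fin 3) (w.1.adicCompletion L)) : Matrix (Fin 3) (Fin 3) (w.1.adicCompletion L)) := by
    rw [hδw, hmx, Matrix.map_mul, Matrix.map_mul, Matrix.coe_units_inv, map_nonsing_inv_of_isUnit evw _ (Matrix.isUnits_det_units x), hPi, hPv]
  -- `φ(δ)_w = P·Y₀·P⁻¹` and `X_δ = P(1 + W)P⁻¹`
  have hNu : IsUnit ((2 : w.1.adicCompletion L) • (1 : Matrix (Fin 3) (Fin 3) (w.1.adicCompletion L)) + (cw - 1) • W).det := by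
    obtain ⟨d, -, hd⟩ := hm; exact IsUnit.of_mul_eq_one_right d hd
  have hDι : IsUnit ((cw - 1) • ιw + (cw + 1) • (1 : Matrix (Fin 3) (Fin 3) (w.1.adicCompletion L))).det := by
    rw [hιW, smul_one_add_smul_add_smul_one W cw (cw - 1) (cw + 1) (by ring), Matrix.det_smul]
    exact (IsUnit.pow _ (isUnit_iff_ne_zero.2 hc0)).mul hNu
  have hφι : ((cw + 1) • ιw + (cw - 1) • (1 : Matrix (Fin 3) (Fin 3) (w.1.adicCompletion L))) * ((cw - 1) • ιw + (cw + 1) • (1 : Matrix (Fin 3) (Fin 3) (w.1.adicCompletion L)))⁻¹ = Y₀ := by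
    rw [hιW]; exact moebius_one_add_smul_eq W hc0 hNu
  -- the `E_v`-level denominator of `δ` is a unit (one place above `v`; its `w`-component is `det P · (c_w³ det N₋) · det P⁻¹`)
  have hDδ : IsUnit ((c - 1) • ((δ.val : GL (Fin 3) (LocalRing L v)).val : Matrix (Fin 3) (Fin 3) (LocalRing L v)) + (c + 1) • (1 : Matrix (Fin 3) (Fin 3) (LocalRing L v))).det := by
    refine isUnit_localRing_of_ne_zero_of_subsingleton L v hv fun h0 => ?_
    have hw0 := congrFun h0 w
    have e1 : (((c - 1) • ((δ.val : GL (Fin 3) (LocalRing L v)).val : Matrix (Fin 3) (Fin 3) (LocalRing L v)) + (c + 1) • (1 : Matrix (Fin 3) (Fin 3) (LocalRing L v))).det) w =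
        ((cw - 1) • δw + (cw + 1) • (1 : Matrix (Fin 3) (Fin 3) (w.1.adicCompletion L))).det := by
      have e0 : (((c - 1) • ((δ.val : GL (Fin 3) (LocalRing L v)).val : Matrix (Fin 3) (Fin 3) (LocalRing L v)) + (c + 1) • (1 : Matrix (Fin 3) (Fin 3) (LocalRing L v))).det) w =
          evw (((c - 1) • ((δ.val : GL (Fin 3) (LocalRing L v)).val : Matrix (Fin 3) (Fin 3) (LocalRing L v)) + (c + 1) • (1 : Matrix (Fin 3) (Fin 3) (LocalRing L v))).det) := rfl
      rw [e0, RingHom.map_det, RingHom.mapMatrix_apply, map_smul_add_smul_one]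
      rfl
    rw [e1, Pi.zero_apply, hδconj, smul_units_conj_add_smul_one P ιw (cw - 1) (cw + 1), Matrix.det_units_conj] at hw0
    exact hDι.ne_zero hw0
  have hYw : ((δ'.val : GL (Fin 3) (LocalRing L v)).val.map evw) = (P : Matrix (Fin 3) (Fin 3) (w.1.adicCompletion L)) * Y₀ * ((P⁻¹ : GL (Fin 3) (w.1.adicCompletion L)) : Matrix (Fin 3) (Fin 3) (w.1.adicCompletion L)) := by
    rw [hδ, map_moebius evw _ _ _ hDδ, map_add, map_sub, map_one]
    change ((cw + 1) • δw + (cw - 1) • (1 : Matrix (Fin 3) (Fin 3) (w.1.adicCompletion L))) * ((cw - 1) • δw + (cw + 1) • 1)⁻¹ = _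
    rw [hδconj, Matrix.coe_units_inv, moebius_conj _ _ (Matrix.isUnits_det_units P) _ _ hDι, hφι]
  have hXw : 1 + cw⁻¹ • (δw - 1) = (P : Matrix (Fin 3) (Fin 3) (w.1.adicCompletion L)) * (1 + W) * ((P⁻¹ : GL (Fin 3) (w.1.adicCompletion L)) : Matrix (Fin 3) (Fin 3) (w.1.adicCompletion L)) := by
    have h1 := smul_units_conj_add_smul_one P ιw cw⁻¹ (1 - cw⁻¹)
    have e2 : cw⁻¹ • ιw + (1 - cw⁻¹) • (1 : Matrix (Fin 3) (Fin 3) (w.1.adicCompletion L)) = 1 + W := by rw [hW, smul_sub, sub_smul, one_smul]; abel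
    rw [e2] at h1
    rw [← h1, hδconj, smul_sub, sub_smul, one_smul]
    abel
  -- transport of the three memberships along `P`
  refine ⟨?_, ?_, ?_⟩
  · rw [hYw]
    change _ ∈ Algebra.adjoin O ({1 + cw⁻¹ • (δw - 1)} : Set (Matrix (Fin 3) (Fin 3) (w.1.adicCompletion L)))
    rw [hXw]
    exact conj_mem_adjoin_of_mem_adjoin O P (mem_adjoin_one_add_of_mem_adjoin O hY₀mem)
  · rw [hYw, units_conj_nonsing_inv P Y₀ (by rw [hY₀, Matrix.det_mul]; exact (by obtain ⟨d, -, hd⟩ := hp; exact IsUnit.of_mul_eq_one_right d hd : IsUnit _).mul (Matrix.isUnit_nonsing_inv_det _ hNu))]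
    change _ ∈ Algebra.adjoin O ({1 + cw⁻¹ • (δw - 1)} : Set (Matrix (Fin 3) (Fin 3) (w.1.adicCompletion L)))
    rw [hXw]
    exact conj_mem_adjoin_of_mem_adjoin O P (mem_adjoin_one_add_of_mem_adjoin O hY₀inv)
  · change 1 + cw⁻¹ • (δw - 1) ∈ Algebra.adjoin O ({((δ'.val : GL (Fin 3) (LocalRing L v)).val.map evw)} : Set (Matrix (Fin 3) (Fin 3) (w.1.adicCompletion L)))
    rw [hXw, hYw]
    exact conj_mem_adjoin_of_mem_adjoin O P (one_add_mem_adjoin_of_mem O hWmem)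

end Literature.NumberTheory.Rogawski1990

end
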